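import Mathlib
import HarnessLib
import Literature.Analysis.FluidPDE.ClassicalSolution
import Literature.Analysis.FluidPDE.LerayHopf
import Literature.Analysis.FluidPDE.TaoLocalisationHolds
import Literature.Analysis.FluidPDE.TaoFiniteEnergyLerayHopf
import Literature.Analysis.FluidPDE.LeslieShvydkoy2018BlowupFrame
import Summits.NavierStokesRegularity.NavierStokesRegularity.Theorems.QuarterJoltSliceTestStaticH1
import Summits.NavierStokesRegularity.NavierStokesRegularity.Theorems.QuarterJoltSliceTestIncrement
import Summits.NavierStokesRegularity.NavierStokesRegularity.Theorems.CertifiedBlowupCertifiedBlowupAxisymBlowupEnergyDrain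

/-!
# Route QuarterJolt — crux `NoTerminalJolt` (stmt-NavierStokesRegularity-26463), LEAD line
# `regular_split` rev 5: SLICE TESTING, `H¹` form, III — `∫⟪u(T), u(t)⟫ − ∫‖u(t)‖²` under an
# ENSTROPHY RATE

Seat ns-ntj-p1 g4 (LEAD of the crux; `--supports 26463 --as helper`). Third file of the
ENSTROPHY-RATE ENERGY EQUALITY chain (`…TransportL4` → `…StaticH1` p-pending → THIS →
`QuarterJoltEnstrophyRateEnergyEquality`). Frame: `(u,p)` classical on `[0,T)` (`ν, T > 0`),
Leray–Hopf on `[0,T]` from a rapidly decaying datum; rate hypothesis `∫|Du(τ)|²_F ≤ M (T−τ)^{−α}`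
(`M ≥ 0`, `0 < α < 4/3`, `β = 3α/4 < 1`), under which the transport contribution
`K^{3/2} I₀^{1/4} ‖Du(t)‖₂ ∫ₜ Z(τ)^{3/4} dτ ≤ K^{3/2} I₀^{1/4} ‖Du(t)‖₂ M^{3/4} (T−t)^{1−β}/(1−β)` is
integrable up to `T`.

* `lintegral_rpow_rate_le` (rate integral), `sliceTestH1_increment_abs_le_slab` (closed slab in
  Tao's class, as `sliceTest_increment_abs_le_slab` p639097 with `sliceTest_abs_le_of_classical_H1`):
  `|∫⟪u(s),u(t)⟫ − ∫‖u(t)‖²| ≤ (ν/2)η∫ₜˢ∫|Du|²_F + (ν/2)η⁻¹Z(s−t) + K^{3/2}I₀^{1/4}√Z M^{3/4}(T'−t)^{1−β}/(1−β)`;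
  the frame version (`s ↑ T`) is in `QuarterJoltEnstrophyRateEnergyEquality.lean`.

HONEST FRAMING: a priori estimates under a (hypothetical) enstrophy rate; nothing here concerns the
truth of `NoTerminalJolt` or Navier–Stokes regularity. No summit statement is proved here. [folklore]
-/

noncomputable section

-- the summit and its single sub-problem share the name (CONVENTIONS §1), as in every Theorems file
set_option linter.dupNamespace false

namespace Summit.NavierStokesRegularity.NavierStokesRegularity.Theorems

open MeasureTheory Set Function Filter Topology InnerProductSpace
open scoped ENNReal NNReal ContDiff RealInnerProductSpace
open Literature.Analysis.FluidPDE

namespace NoTerminalJolt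

/-! ### The rate integral -/

/-- `∫⁻_{(t₀,t)} ofReal (c (T−τ)^{−β}) ≤ ofReal (c (T−t₀)^{1−β}/(1−β))` for `0 < β < 1`, `c ≥ 0`,
`t₀ ≤ t < T` (the tree's `LeslieShvydkoy2018.lintegral_rate_le` with `q = 1/β`). [folklore] -/
theorem lintegral_rpow_rate_le {c β T t₀ t : ℝ} (hc : 0 ≤ c) (hβ0 : 0 < β) (hβ1 : β < 1)
    (ht₀t : t₀ ≤ t) (htT : t < T) :
    ∫⁻ τ in Ioo t₀ t, ENNReal.ofReal (c * (T - τ) ^ (-β)) ≤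
      ENNReal.ofReal (c * ((T - t₀) ^ (1 - β) / (1 - β))) := by
  have hq : 1 < 1 / β := by rw [lt_div_iff₀ hβ0]; linarith
  have h := LeslieShvydkoy2018.lintegral_rate_le (T := T) (q := 1 / β) (c₀ := c) hc hq ht₀t htT
  simpa only [one_div_one_div] using h

/-! ### The slice-test increment on a closed slab under an enstrophy rate -/

/-- **The slice-test increment on a closed slab under an ENSTROPHY RATE** (`(u,p)` classical on
`[0,S]×ℝ³` in Tao's class, `∫‖u(τ)‖² ≤ I₀`, `0 < t < s < S < T'`… precisely `s < T'`; rate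
`∫|Du(τ)|²_F ≤ M (T'−τ)^{−α}` on `(t,s)`, `M ≥ 0`, `0 < α < 4/3`; `η > 0`; `Z = ∫|Du(t)|²_F`):
`|∫⟪u(s),u(t)⟫ − ∫‖u(t)‖²| ≤ (ν/2)η(∫⁻_{(t,s)}∫⁻|Du|²_F).toReal + (ν/2)η⁻¹Z(s−t)
  + K^{3/2} I₀^{1/4} √Z M^{3/4} (T'−t)^{1−3α/4}/(1−3α/4)`. [folklore] -/
theorem sliceTestH1_increment_abs_le_slab {ν S : ℝ} (hν : 0 < ν) (hS : 0 < S)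
    {u : ℝ → EuclideanSpace ℝ (Fin 3) → EuclideanSpace ℝ (Fin 3)} {p : ℝ → EuclideanSpace ℝ (Fin 3) → ℝ}
    (hsol : IsClassicalNSSolutionOn (Icc 0 S) ν 0 u p) (hB : HasBoundedSobolevNormsOn (Icc 0 S) u)
    {I₀ : ℝ} (hI₀le : ∀ τ ∈ Icc 0 S, ∫ x, ‖u τ x‖ ^ 2 ≤ I₀)
    {t s : ℝ} (ht : 0 < t) (hts : t < s) (hsS : s < S)
    {T' M α : ℝ} (hsT' : s < T') (hM : 0 ≤ M) (hα0 : 0 < α) (hα : α < 4 / 3)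
    (hZ : ∀ τ ∈ Ioo t s, ∫ x, frobeniusNormSq (fderiv ℝ (u τ) x) ≤ M * (T' - τ) ^ (-α))
    {η : ℝ} (hη : 0 < η) :
    |(∫ x, ⟪u s x, u t x⟫) - ∫ x, ‖u t x‖ ^ 2| ≤
      ν / 2 * η *
          (∫⁻ τ in Ioo t s, ∫⁻ x, ENNReal.ofReal (frobeniusNormSq (fderiv ℝ (u τ) x))).toReal +
        ν / 2 * η⁻¹ * (∫ x, frobeniusNormSq (fderiv ℝ (u t) x)) * (s - t) +
        (SNormLESNormFDerivOfEqConst (EuclideanSpace ℝ (Fin 3))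
            (volume : Measure (EuclideanSpace ℝ (Fin 3))) 2 : ℝ) ^ (3 / 2 : ℝ) *
          I₀ ^ (1 / 4 : ℝ) * Real.sqrt (∫ x, frobeniusNormSq (fderiv ℝ (u t) x)) *
          M ^ (3 / 4 : ℝ) * ((T' - t) ^ (1 - 3 * α / 4) / (1 - 3 * α / 4)) := by
  set Kc : ℝ := (SNormLESNormFDerivOfEqConst (EuclideanSpace ℝ (Fin 3))
    (volume : Measure (EuclideanSpace ℝ (Fin 3))) 2 : ℝ) with hKc
  have hKc0 : 0 ≤ Kc := NNReal.coe_nonneg _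
  set β : ℝ := 3 * α / 4 with hβ
  have hβ0 : 0 < β := by rw [hβ]; positivity
  have hβ1 : β < 1 := by rw [hβ]; linarith
  have hUI : UniqueDiffOn ℝ (Icc 0 S) := uniqueDiffOn_Icc hS
  have hu : ∀ τ ∈ Icc 0 S, ContDiff ℝ ∞ (u τ) := fun τ hτ => hsol.contDiff_velocity hτ
  have htI : t ∈ Ioc 0 S := ⟨ht, (hts.trans hsS).le⟩
  have htI' : t ∈ Icc 0 S := ⟨ht.le, htI.2⟩
  have hsI : s ∈ Ioc 0 S := ⟨ht.trans hts, hsS.le⟩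
  have hI₀0 : 0 ≤ I₀ := (integral_nonneg fun x => sq_nonneg _).trans (hI₀le t htI')
  set U : EuclideanSpace ℝ (Fin 3) → EuclideanSpace ℝ (Fin 3) := u t with hUdef
  have hUs : ContDiff ℝ ∞ U := hu t htI'
  have hU1 : ContDiff ℝ 1 U := hUs.of_le (by norm_cast)
  have cU : Continuous U := hUs.continuous
  have hdivU : VectorCalculus.IsDivFree U := hsol.divFree t htI'
  obtain ⟨C₀, hC₀⟩ := hB 0
  obtain ⟨C₁, hC₁⟩ := hB 1
  have hzero : ∀ σ ∈ Icc 0 S, ∫⁻ x, ‖u σ x‖ₑ ^ 2 ≤ C₀ := fun σ hσ => by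
    refine (le_of_eq (lintegral_congr fun x => ?_)).trans (hC₀ σ hσ)
    rw [← ofReal_norm, ← ofReal_norm, norm_iteratedFDeriv_zero]
  have l2sl : ∀ τ ∈ Icc 0 S, ∫⁻ x, ‖u τ x‖ₑ ^ 2 < ⊤ := fun τ hτ =>
    (hzero τ hτ).trans_lt ENNReal.coe_lt_top
  have cut : ∀ τ ∈ Icc 0 S, Continuous (u τ) := fun τ hτ => (hu τ hτ).continuous
  have hmu : ∀ τ ∈ Icc 0 S, MemLp (u τ) 2 volume := fun τ hτ =>
    memLp_two_of_lintegral_lt_top (cut τ hτ) (l2sl τ hτ)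
  have l2U : ∫⁻ x, ‖U x‖ₑ ^ 2 < ⊤ := l2sl t htI'
  have hmU : MemLp U 2 volume := hmu t htI'
  have l2DU : ∫⁻ x, ‖fderiv ℝ U x‖ₑ ^ 2 < ⊤ :=
    lintegral_enorm_sq_lt_top_of_norm_le (fun x => by
      rw [← norm_iteratedFDeriv_fderiv, norm_iteratedFDeriv_zero])
      ((hC₁ t htI').trans_lt ENNReal.coe_lt_top)
  obtain ⟨Λ, hΛtop, hΛ⟩ := hsol.exists_lintegral_enorm_timeDerivWithin_sq_le hν.le hS hB
  set W : ℝ → EuclideanSpace ℝ (Fin 3) → EuclideanSpace ℝ (Fin 3) := timeDerivWithin (Icc 0 S) u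
    with hWdef
  have hWsm : IsSmoothSpaceTimeOn (Icc 0 S) W := hsol.smooth_velocity.timeDerivWithin hUI
  have cWt : ∀ τ ∈ Icc 0 S, Continuous (W τ) := fun τ hτ => (hWsm.contDiff_slice hτ).continuous
  have l2Wt : ∀ τ ∈ Icc 0 S, ∫⁻ x, ‖W τ x‖ₑ ^ 2 < ⊤ := fun τ hτ => (hΛ τ hτ).trans_lt hΛtop.lt_top
  have hC₁u : ∀ τ ∈ Icc 0 S, ∫⁻ x, ‖timeDerivWithin (Icc 0 S) u τ x‖ₑ ^ 2 ≤ Λ.toNNReal := by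
    intro τ hτ; rw [ENNReal.coe_toNNReal hΛtop]; exact hΛ τ hτ
  obtain ⟨hΦu_int, -, hEu⟩ := hsol.smooth_velocity.l2_balance hS hzero hC₁u
  obtain ⟨w, hwdef⟩ : ∃ w : ℝ → EuclideanSpace ℝ (Fin 3) → EuclideanSpace ℝ (Fin 3),
      w = fun τ x => u τ x - U x := ⟨_, rfl⟩
  have hwtx : ∀ τ x, w τ x = u τ x - U x := fun τ x => by rw [hwdef]
  have hconst : IsSmoothSpaceTimeOn (Icc 0 S) (fun (_ : ℝ) (x : EuclideanSpace ℝ (Fin 3)) => U x) := by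
    have hc : ContDiff ℝ ∞ (uncurry fun (_ : ℝ) (x : EuclideanSpace ℝ (Fin 3)) => U x) :=
      hUs.comp contDiff_snd
    exact hc.contDiffOn
  have hwsm : IsSmoothSpaceTimeOn (Icc 0 S) w := by
    rw [hwdef]; exact hsol.smooth_velocity.sub hconst
  have hWt : ∀ τ ∈ Icc 0 S, ∀ x, timeDerivWithin (Icc 0 S) w τ x = W τ x := by
    intro τ hτ x
    rw [hwdef, hsol.smooth_velocity.timeDerivWithin_fun_sub hconst hUI hτ x]
    simp [hWdef, timeDerivWithin_apply]
  have hwL2 : ∀ τ ∈ Icc 0 S, ∫⁻ x, ‖w τ x‖ₑ ^ 2 ≤ (2 * C₀ + 2 * (∫⁻ x, ‖U x‖ₑ ^ 2).toNNReal : ℝ≥0) := by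
    intro τ hτ
    have h := lintegral_enorm_sq_sub_le (g := U) ((cut τ hτ).aestronglyMeasurable) (μ := volume)
    calc ∫⁻ x, ‖w τ x‖ₑ ^ 2 = ∫⁻ x, ‖u τ x - U x‖ₑ ^ 2 := lintegral_congr fun x => by rw [hwtx]
      _ ≤ 2 * (∫⁻ x, ‖u τ x‖ₑ ^ 2) + 2 * ∫⁻ x, ‖U x‖ₑ ^ 2 := h
      _ ≤ 2 * (C₀ : ℝ≥0∞) + 2 * ((∫⁻ x, ‖U x‖ₑ ^ 2).toNNReal : ℝ≥0∞) := by
          gcongr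
          · exact hzero τ hτ
          · exact le_of_eq (ENNReal.coe_toNNReal l2U.ne).symm
      _ = ((2 * C₀ + 2 * (∫⁻ x, ‖U x‖ₑ ^ 2).toNNReal : ℝ≥0) : ℝ≥0∞) := by push_cast; rfl
  have hWL2 : ∀ τ ∈ Icc 0 S, ∫⁻ x, ‖timeDerivWithin (Icc 0 S) w τ x‖ₑ ^ 2 ≤ Λ.toNNReal := by
    intro τ hτ
    rw [ENNReal.coe_toNNReal hΛtop]
    refine (le_of_eq (lintegral_congr fun x => ?_)).trans (hΛ τ hτ)
    rw [hWt τ hτ x]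
  obtain ⟨hΦw_int, -, hEw⟩ := hwsm.l2_balance hS hwL2 hWL2
  set Φu : ℝ → ℝ := fun τ => ∫ x, 2 * ⟪u τ x, timeDerivWithin (Icc 0 S) u τ x⟫ with hΦu
  set Φw : ℝ → ℝ := fun τ => ∫ x, 2 * ⟪w τ x, timeDerivWithin (Icc 0 S) w τ x⟫ with hΦw
  set Ψ : ℝ → ℝ := fun τ => (Φu τ - Φw τ) / 2 with hΨ
  set P : ℝ → ℝ := fun τ => ∫ x, ⟪u τ x, U x⟫ with hP
  have hΨ_int : IntegrableOn Ψ (Ioo 0 S) := (hΦu_int.sub hΦw_int).div_const 2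
  have hpol : ∀ τ ∈ Icc 0 S, P τ = ((∫ x, ‖u τ x‖ ^ 2) + (∫ x, ‖U x‖ ^ 2) - ∫ x, ‖w τ x‖ ^ 2) / 2 := by
    intro τ hτ
    have h := integral_norm_sub_sq_eq (hmu τ hτ) hmU
    have hw' : ∫ x, ‖w τ x‖ ^ 2 = ∫ x, ‖u τ x - U x‖ ^ 2 :=
      integral_congr_ae (Eventually.of_forall fun x => by simp only [hwtx])
    simp only [hP]
    rw [hw', h]
    ring
  have hincr : ∀ b ∈ Ioc 0 S, P b - P 0 = ∫ τ in (0 : ℝ)..b, Ψ τ := by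
    intro b hb
    have h0 : (0 : ℝ) ∈ Icc 0 S := ⟨le_rfl, hS.le⟩
    have hbI : b ∈ Icc 0 S := ⟨hb.1.le, hb.2⟩
    have e1 := hEu b hb
    have e2 := hEw b hb
    have hiu : IntervalIntegrable Φu volume 0 b :=
      (intervalIntegrable_iff_integrableOn_Ioo_of_le hb.1.le).2
        (hΦu_int.mono_set (Ioo_subset_Ioo le_rfl hb.2))
    have hiw : IntervalIntegrable Φw volume 0 b :=
      (intervalIntegrable_iff_integrableOn_Ioo_of_le hb.1.le).2
        (hΦw_int.mono_set (Ioo_subset_Ioo le_rfl hb.2))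
    have e3 : ∫ τ in (0 : ℝ)..b, Ψ τ = ((∫ τ in (0 : ℝ)..b, Φu τ) - ∫ τ in (0 : ℝ)..b, Φw τ) / 2 := by
      simp only [hΨ]
      rw [intervalIntegral.integral_div, intervalIntegral.integral_sub hiu hiw]
    rw [e3, hpol b hbI, hpol 0 h0]
    simp only [hΦu, hΦw] at e1 e2 ⊢
    linarith
  have hΨii : ∀ a b : ℝ, 0 ≤ a → b ≤ S → a ≤ b → IntervalIntegrable Ψ volume a b :=
    fun a b ha hb hab =>
      (intervalIntegrable_iff_integrableOn_Ioo_of_le hab).2 (hΨ_int.mono_set (Ioo_subset_Ioo ha hb))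
  have hPst : P s - P t = ∫ τ in Ioo t s, Ψ τ := by
    have h1 := hincr s hsI
    have h2 := hincr t htI
    have h3 := intervalIntegral.integral_interval_sub_left (hΨii 0 s le_rfl hsI.2 hsI.1.le)
      (hΨii 0 t le_rfl htI.2 htI.1.le)
    rw [intervalIntegral.integral_of_le hts.le, integral_Ioc_eq_integral_Ioo] at h3
    linarith
  have hΨeq : ∀ τ ∈ Icc 0 S, Ψ τ = ∫ x, ⟪U x, W τ x⟫ := by
    intro τ hτ
    have iu : Integrable (fun x => 2 * ⟪u τ x, timeDerivWithin (Icc 0 S) u τ x⟫) volume := by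
      refine (integrable_of_norm_le_mul_of_lintegral_sq ((cut τ hτ).inner (cWt τ hτ)).aestronglyMeasurable
        (cut τ hτ) (cWt τ hτ) (l2sl τ hτ) (l2Wt τ hτ) fun x => norm_inner_le_norm _ _).const_mul 2
    have cwt : Continuous (w τ) := (hwsm.contDiff_slice hτ).continuous
    have l2wt : ∫⁻ x, ‖w τ x‖ₑ ^ 2 < ⊤ := (hwL2 τ hτ).trans_lt ENNReal.coe_lt_top
    have iw : Integrable (fun x => 2 * ⟪w τ x, timeDerivWithin (Icc 0 S) w τ x⟫) volume := by
      have h1 : Integrable (fun x => ⟪w τ x, W τ x⟫) volume :=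
        integrable_of_norm_le_mul_of_lintegral_sq (cwt.inner (cWt τ hτ)).aestronglyMeasurable
          cwt (cWt τ hτ) l2wt (l2Wt τ hτ) fun x => norm_inner_le_norm _ _
      refine (h1.const_mul 2).congr (Eventually.of_forall fun x => ?_)
      simp only [hWt τ hτ x]
    simp only [hΨ, hΦu, hΦw]
    rw [← integral_sub iu iw]
    have hpt : (fun x => 2 * ⟪u τ x, timeDerivWithin (Icc 0 S) u τ x⟫ -
        2 * ⟪w τ x, timeDerivWithin (Icc 0 S) w τ x⟫) = fun x => 2 * ⟪U x, W τ x⟫ := by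
      funext x
      rw [hWt τ hτ x, hwtx, inner_sub_left, real_inner_comm (W τ x) (U x)]
      simp only [hWdef]
      ring
    rw [hpt, integral_const_mul]
    ring
  set ZU : ℝ := ∫ x, frobeniusNormSq (fderiv ℝ U x) with hZU
  set a : ℝ := ν / 2 * η with ha
  set K : ℝ := ν / 2 * η⁻¹ * ZU with hK
  set c : ℝ := Kc ^ (3 / 2 : ℝ) * I₀ ^ (1 / 4 : ℝ) * Real.sqrt ZU * M ^ (3 / 4 : ℝ) with hc
  set F : ℝ → ℝ≥0∞ := fun τ => ∫⁻ x, ENNReal.ofReal (frobeniusNormSq (fderiv ℝ (u τ) x)) with hF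
  have ha0 : 0 ≤ a := by rw [ha]; positivity
  have hZU0 : 0 ≤ ZU := integral_nonneg fun x => frobeniusNormSq_nonneg _
  have hK0 : 0 ≤ K := by rw [hK]; positivity
  have hc0 : 0 ≤ c := by rw [hc]; positivity
  have hbound : ∀ τ ∈ Ioo t s, ENNReal.ofReal ‖Ψ τ‖ ≤
      ENNReal.ofReal a * F τ + ENNReal.ofReal K + ENNReal.ofReal (c * (T' - τ) ^ (-β)) := by
    intro τ hτ
    have hτS : τ ∈ Ioo 0 S := ⟨ht.trans hτ.1, hτ.2.trans hsS⟩
    have hτS' : τ ∈ Icc 0 S := Ioo_subset_Icc_self hτS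
    have hest := sliceTest_abs_le_of_classical_H1 hν hS hsol hB hI₀le hτS hU1 hdivU l2U l2DU hη
    rw [← hΨeq τ hτS', ← hKc] at hest
    have hGeq : ∫ x, frobeniusNormSq (fderiv ℝ (u τ) x) = (F τ).toReal :=
      integral_eq_lintegral_of_nonneg_ae (Eventually.of_forall fun x => frobeniusNormSq_nonneg _)
        (continuous_frobeniusNormSq_fderiv (hu τ hτS') (by simp)).aestronglyMeasurable
    have hFfin : F τ ≠ ⊤ := by
      refine (lt_of_le_of_lt ?_ (ENNReal.mul_lt_top (by norm_num : (3 : ℝ≥0∞) < ⊤)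
        ((hC₁ τ hτS').trans_lt ENNReal.coe_lt_top))).ne
      calc F τ ≤ ∫⁻ x, 3 * ‖fderiv ℝ (u τ) x‖ₑ ^ 2 :=
            lintegral_mono fun x => ofReal_frobeniusNormSq_le_three_mul_enorm_sq _
        _ = 3 * ∫⁻ x, ‖fderiv ℝ (u τ) x‖ₑ ^ 2 := lintegral_const_mul' _ _ (by norm_num)
        _ = 3 * ∫⁻ x, ‖iteratedFDeriv ℝ 1 (u τ) x‖ₑ ^ 2 := by
            congr 1
            exact lintegral_congr fun x => by
              rw [← ofReal_norm, ← ofReal_norm, ← norm_iteratedFDeriv_fderiv, norm_iteratedFDeriv_zero]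
    have hTτ : 0 ≤ T' - τ := by linarith [hτ.2, hsT']
    have hZτ0 : 0 ≤ ∫ x, frobeniusNormSq (fderiv ℝ (u τ) x) :=
      integral_nonneg fun x => frobeniusNormSq_nonneg _
    have hpow : (∫ x, frobeniusNormSq (fderiv ℝ (u τ) x)) ^ (3 / 4 : ℝ) ≤
        M ^ (3 / 4 : ℝ) * (T' - τ) ^ (-β) := by
      have h1 := Real.rpow_le_rpow hZτ0 (hZ τ hτ) (by norm_num : (0 : ℝ) ≤ 3 / 4)
      rw [Real.mul_rpow hM (Real.rpow_nonneg hTτ _), ← Real.rpow_mul hTτ] at h1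
      have e : -α * (3 / 4 : ℝ) = -β := by rw [hβ]; ring
      rwa [e] at h1
    have htrans : Kc ^ (3 / 2 : ℝ) * I₀ ^ (1 / 4 : ℝ) *
        (∫ x, frobeniusNormSq (fderiv ℝ (u τ) x)) ^ (3 / 4 : ℝ) * Real.sqrt ZU ≤
        c * (T' - τ) ^ (-β) := by
      have hpre : 0 ≤ Kc ^ (3 / 2 : ℝ) * I₀ ^ (1 / 4 : ℝ) := by positivity
      have h1 := mul_le_mul_of_nonneg_left hpow hpre
      have h2 := mul_le_mul_of_nonneg_right h1 (Real.sqrt_nonneg ZU)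
      rw [hc]
      calc Kc ^ (3 / 2 : ℝ) * I₀ ^ (1 / 4 : ℝ) *
            (∫ x, frobeniusNormSq (fderiv ℝ (u τ) x)) ^ (3 / 4 : ℝ) * Real.sqrt ZU
          ≤ Kc ^ (3 / 2 : ℝ) * I₀ ^ (1 / 4 : ℝ) * (M ^ (3 / 4 : ℝ) * (T' - τ) ^ (-β)) *
              Real.sqrt ZU := h2
        _ = Kc ^ (3 / 2 : ℝ) * I₀ ^ (1 / 4 : ℝ) * Real.sqrt ZU * M ^ (3 / 4 : ℝ) *
              (T' - τ) ^ (-β) := by ring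
    have hrate0 : 0 ≤ c * (T' - τ) ^ (-β) := mul_nonneg hc0 (Real.rpow_nonneg hTτ _)
    have halg : ν / 2 * (η * (F τ).toReal + η⁻¹ * ZU) = a * (F τ).toReal + K := by
      rw [ha, hK]; ring
    rw [Real.norm_eq_abs]
    calc ENNReal.ofReal |Ψ τ|
        ≤ ENNReal.ofReal (a * (F τ).toReal + K + c * (T' - τ) ^ (-β)) := by
          refine ENNReal.ofReal_le_ofReal ?_
          rw [← halg, ← hGeq]
          exact hest.trans (add_le_add le_rfl htrans)
      _ = ENNReal.ofReal a * F τ + ENNReal.ofReal K + ENNReal.ofReal (c * (T' - τ) ^ (-β)) := by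
          rw [ENNReal.ofReal_add (by positivity) hrate0, ENNReal.ofReal_add (by positivity) hK0,
            ENNReal.ofReal_mul ha0, ENNReal.ofReal_toReal hFfin]
  have hrate := lintegral_rpow_rate_le (T := T') hc0 hβ0 hβ1 hts.le hsT'
  set Rt : ℝ := c * ((T' - t) ^ (1 - β) / (1 - β)) with hRt
  have hRt0 : 0 ≤ Rt := by
    rw [hRt]
    have : 0 ≤ (T' - t) ^ (1 - β) := Real.rpow_nonneg (by linarith) _
    have : 0 < 1 - β := by linarith
    positivity
  have hlin : ∫⁻ τ in Ioo t s, ENNReal.ofReal ‖Ψ τ‖ ≤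
      ENNReal.ofReal a * (∫⁻ τ in Ioo t s, F τ) + ENNReal.ofReal K * ENNReal.ofReal (s - t) +
        ENNReal.ofReal Rt := by
    calc ∫⁻ τ in Ioo t s, ENNReal.ofReal ‖Ψ τ‖
        ≤ ∫⁻ τ in Ioo t s,
            (ENNReal.ofReal a * F τ + ENNReal.ofReal K + ENNReal.ofReal (c * (T' - τ) ^ (-β))) :=
          setLIntegral_mono' measurableSet_Ioo fun τ hτ => hbound τ hτ
      _ = ENNReal.ofReal a * (∫⁻ τ in Ioo t s, F τ) + ENNReal.ofReal K * ENNReal.ofReal (s - t) +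
            ∫⁻ τ in Ioo t s, ENNReal.ofReal (c * (T' - τ) ^ (-β)) := by
          have hm : Measurable fun τ => ENNReal.ofReal (c * (T' - τ) ^ (-β)) :=
            (measurable_const.mul ((measurable_const.sub measurable_id).pow_const _)).ennreal_ofReal
          rw [lintegral_add_right _ hm, lintegral_add_right _ measurable_const,
            lintegral_const_mul' _ _ ENNReal.ofReal_ne_top,
            lintegral_const, Measure.restrict_apply MeasurableSet.univ, univ_inter, Real.volume_Ioo]
      _ ≤ _ := add_le_add le_rfl hrate
  have hDfin : (∫⁻ τ in Ioo t s, F τ) ≠ ⊤ := by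
    have hle : ∀ τ ∈ Ioo t s, F τ ≤ 3 * (C₁ : ℝ≥0∞) := by
      intro τ hτ
      have hτS' : τ ∈ Icc 0 S := ⟨(ht.trans hτ.1).le, (hτ.2.trans hsS).le⟩
      calc F τ ≤ ∫⁻ x, 3 * ‖fderiv ℝ (u τ) x‖ₑ ^ 2 :=
            lintegral_mono fun x => ofReal_frobeniusNormSq_le_three_mul_enorm_sq _
        _ = 3 * ∫⁻ x, ‖fderiv ℝ (u τ) x‖ₑ ^ 2 := lintegral_const_mul' _ _ (by norm_num)
        _ ≤ 3 * (C₁ : ℝ≥0∞) := by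
            refine mul_le_mul' le_rfl ((le_of_eq (lintegral_congr fun x => ?_)).trans (hC₁ τ hτS'))
            rw [← ofReal_norm, ← ofReal_norm, ← norm_iteratedFDeriv_fderiv, norm_iteratedFDeriv_zero]
    refine (lt_of_le_of_lt (setLIntegral_mono' measurableSet_Ioo fun τ hτ => hle τ hτ) ?_).ne
    rw [lintegral_const, Measure.restrict_apply MeasurableSet.univ, univ_inter, Real.volume_Ioo]
    exact ENNReal.mul_lt_top (ENNReal.mul_lt_top (by norm_num) ENNReal.coe_lt_top) ENNReal.ofReal_lt_top
  have hnorm := norm_integral_le_lintegral_norm (μ := volume.restrict (Ioo t s)) Ψ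
  rw [Real.norm_eq_abs] at hnorm
  have hfinR : ENNReal.ofReal a * (∫⁻ τ in Ioo t s, F τ) + ENNReal.ofReal K * ENNReal.ofReal (s - t) +
      ENNReal.ofReal Rt ≠ ⊤ :=
    ENNReal.add_ne_top.2 ⟨ENNReal.add_ne_top.2 ⟨ENNReal.mul_ne_top ENNReal.ofReal_ne_top hDfin,
      ENNReal.mul_ne_top ENNReal.ofReal_ne_top ENNReal.ofReal_ne_top⟩, ENNReal.ofReal_ne_top⟩
  have htoReal : (∫⁻ τ in Ioo t s, ENNReal.ofReal ‖Ψ τ‖).toReal ≤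
      a * (∫⁻ τ in Ioo t s, F τ).toReal + K * (s - t) + Rt := by
    have h := (ENNReal.toReal_le_toReal (ne_top_of_le_ne_top hfinR hlin) hfinR).2 hlin
    rw [ENNReal.toReal_add (ENNReal.add_ne_top.2 ⟨ENNReal.mul_ne_top ENNReal.ofReal_ne_top hDfin,
        ENNReal.mul_ne_top ENNReal.ofReal_ne_top ENNReal.ofReal_ne_top⟩) ENNReal.ofReal_ne_top,
      ENNReal.toReal_add (ENNReal.mul_ne_top ENNReal.ofReal_ne_top hDfin)
        (ENNReal.mul_ne_top ENNReal.ofReal_ne_top ENNReal.ofReal_ne_top), ENNReal.toReal_mul,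
      ENNReal.toReal_mul, ENNReal.toReal_ofReal ha0, ENNReal.toReal_ofReal hK0,
      ENNReal.toReal_ofReal (by linarith), ENNReal.toReal_ofReal hRt0] at h
    exact h
  have hPt : P t = ∫ x, ‖u t x‖ ^ 2 := by
    simp only [hP, hUdef]
    exact integral_congr_ae (Eventually.of_forall fun x => real_inner_self_eq_norm_sq _)
  have hgoal : (∫ x, ⟪u s x, u t x⟫) - ∫ x, ‖u t x‖ ^ 2 = P s - P t := by
    rw [hPt]
  rw [hgoal, hPst]
  refine (hnorm.trans htoReal).trans (le_of_eq ?_)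
  simp only [ha, hK, hRt, hc, hZU, hβ]

end NoTerminalJolt

end Summit.NavierStokesRegularity.NavierStokesRegularity.Theorems

end
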